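import Summits.SmoothPoincare4.SmoothPoincare4.Theorems.DottedCircleRasmussenDcrGapHelperFriendsCarrierVkPartAPartILoops
import Literature.Topology.FourManifolds.MMSWPictureSurgeryProofs
import Literature.AlgebraicTopology.SingularHomology.MayerVietorisExactness

/-!
# Helper `helper_friendsCarrier_Vk_partA_partI` (V_k part A, part I: the tube framing is the Seifert
framing), piece 9: the Mayer–Vietoris input and the normal disc of the outer core circle
(line `mk_friends`, crux `DcrGap`; item stmt-SmoothPoincare4-16128, route route-SmoothPoincare4-DottedCircleRasmussen)

Two inputs of the final assembly of part I:

* `FriendsCarrierVk.mv_exists_of_map_eq_zero` — **the Mayer–Vietoris step**: for an open cover `X = U ∪ V`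
  and a class `c ∈ H₁(U; ℤ)` which dies in `X`, there is a class of `H₁(U ∩ V; ℤ)` mapping to `c` in `U` and to
  `0` in `V` (exactness at `H₁(U) ⊕ H₁(V)`, the tree's `mayerVietoris.exact₁_holds`, Hatcher 2002, §2.2);
* `FriendsCarrierVk.loopClass_outerFibre_eq_zero` — **in `M_k ∖ K₁` the fibre circle of the outer core bounds**:
  the `w`-circle `t ↦ (z₁, (√ε/2) e^{2πit})` over a far planar point `z₁` of potential `1 − ε/4` is
  null-homologous in `{y ∈ M_k | y ∉ K₁}` whenever `|w|² ≥ ε` on `K₁`: moving `z₁` outwards along its meridian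
  of latitude (`MMSW.outerZ`, where the potential is strictly decreasing, `planarPot_outerZ_strictAntiOn`) to
  the outer core circle `{g = 1}` shrinks the `w`-circles `|w|² = 1 − g` to a point — the normal disc of the
  core in `M_k`;
* `FriendsCarrierVk.loopClass_pushOff_eq` — push-offs of different radii of a tube in `M_k` have the same class
  in `M_k ∖ K₁`.

* `helper_friendsCarrier_Vk_partA_partI_transfer` — the registered statement.

No definitions, no named facts, no `sorry`.

## References

* A. Hatcher, *Algebraic Topology*, CUP (2002), §2.2 (Mayer–Vietoris), Thm. 2A.1. [HatcherAT2002]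
* R. Kirby, *The Topology of 4-Manifolds*, LNM 1374 (1989), Ch. I §2. [Kirby1989]
-/

set_option linter.dupNamespace false
set_option linter.style.longLine false

noncomputable section

open scoped Manifold ContDiff Topology ComplexConjugate unitInterval
open CategoryTheory CategoryTheory.Limits Function Set Metric TopologicalSpace Literature.Topology.FourManifolds Literature.Topology.FourManifolds.MMSW
  Literature.AlgebraicTopology.Homotopy.HopfFibration Literature.AlgebraicTopology.SingularHomology

namespace Summit.SmoothPoincare4.SmoothPoincare4.Theorems.DcrGap.MkFriends

namespace FriendsCarrierVk

/-! ## The Mayer–Vietoris step -/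

/-- **Mayer–Vietoris**: for an open cover `X = U ∪ V` and `c ∈ H₁(U; ℤ)` with `c ↦ 0` in `H₁(X; ℤ)` there is
`e ∈ H₁(U ∩ V; ℤ)` with `e ↦ c` in `H₁(U)` and `e ↦ 0` in `H₁(V)` (exactness of
`H₁(U ∩ V) → H₁(U) ⊕ H₁(V) → H₁(X)`, Hatcher 2002, §2.2). [cite: HatcherAT2002, §2.2 p. 149] -/
theorem mv_exists_of_map_eq_zero {X : Type} [TopologicalSpace X] (U V : Set X) (hU : IsOpen U) (hV : IsOpen V)
    (hUV : U ∪ V = univ) (c : singularHomology ℤ ℤ ↥U 1) (hc : singularHomology.map ℤ ℤ (subsetIncl U) 1 c = 0) :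
    ∃ e : singularHomology ℤ ℤ ↥(U ∩ V) 1, singularHomology.map ℤ ℤ (subsetInclusion inter_subset_left) 1 e = c ∧
      singularHomology.map ℤ ℤ (subsetInclusion inter_subset_right) 1 e = 0 := by
  have h : interior U ∪ interior V = univ := by rw [hU.interior_eq, hV.interior_eq, hUV]
  have hex := mayerVietoris.exact₁_holds ℤ ℤ U V h 1
  rw [ShortComplex.moduleCat_exact_iff] at hex
  obtain ⟨e, he⟩ := hex ((biprod.inl : singularHomology ℤ ℤ ↥U 1 ⟶ singularHomology ℤ ℤ ↥U 1 ⊞ singularHomology ℤ ℤ ↥V 1) c) (by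
    change mayerVietoris.ψ ℤ ℤ U V 1 _ = 0
    rw [mayerVietoris.ψ, biprod_desc_inl_apply, hc])
  change mayerVietoris.φ ℤ ℤ U V 1 e = _ at he
  refine ⟨e, ?_, ?_⟩
  · have := congrArg (biprod.fst : singularHomology ℤ ℤ ↥U 1 ⊞ singularHomology ℤ ℤ ↥V 1 ⟶ _) he
    rwa [mayerVietoris.φ, biprod_fst_lift_apply, biprod_fst_inl_apply] at this
  · have := congrArg (biprod.snd : singularHomology ℤ ℤ ↥U 1 ⊞ singularHomology ℤ ℤ ↥V 1 ⟶ _) he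
    rw [mayerVietoris.φ, biprod_snd_lift_apply, biprod_snd_inl_apply] at this
    simpa using this

/-! ## Push-offs of different radii -/

/-- **Push-offs of a tube in `M_k` of different radii have the same class in `M_k ∖ K₁`** (the annulus between
them lies in the punctured tube, off `K₁`). [folklore] -/
theorem loopClass_pushOff_eq {k : ℕ} (K₁ : (sphere (0 : EuclideanSpace ℝ (Fin 2)) 1) → EuclideanSpace ℝ (Fin 4))
    (νK : (sphere (0 : EuclideanSpace ℝ (Fin 2)) 1) × EuclideanSpace ℝ (Fin 2) → EuclideanSpace ℝ (Fin 4))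
    (hν : Continuous νK) (hνinj : Injective νK) (hνM : ∀ p, νK p ∈ modelBoundary k)
    (hν0 : ∀ u : (sphere (0 : EuclideanSpace ℝ (Fin 2)) 1), νK (u, 0) = K₁ u) {s s' : ℝ} (hs : 0 < s) (hs' : 0 < s')
    {p p' : ↥{y : EuclideanSpace ℝ (Fin 4) | y ∈ modelBoundary k ∧ y ∉ range K₁}} (γ : Path p p) (γ' : Path p' p')
    (hγ : ∀ t, ((γ t : ↥{y : EuclideanSpace ℝ (Fin 4) | y ∈ modelBoundary k ∧ y ∉ range K₁}) : EuclideanSpace ℝ (Fin 4)) =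
      νK (circlePoint (2 * Real.pi * t), s • EuclideanSpace.single 0 1))
    (hγ' : ∀ t, ((γ' t : ↥{y : EuclideanSpace ℝ (Fin 4) | y ∈ modelBoundary k ∧ y ∉ range K₁}) : EuclideanSpace ℝ (Fin 4)) =
      νK (circlePoint (2 * Real.pi * t), s' • EuclideanSpace.single 0 1)) :
    loopClass ℤ ℤ (1 : ℤ) γ = loopClass ℤ ℤ (1 : ℤ) γ' := by
  have hmem : ∀ q : I × I, νK (circlePoint (2 * Real.pi * q.2), ((1 - (q.1 : ℝ)) * s + (q.1 : ℝ) * s') • EuclideanSpace.single 0 1) ∈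
      {y : EuclideanSpace ℝ (Fin 4) | y ∈ modelBoundary k ∧ y ∉ range K₁} := by
    intro q
    have hr : 0 < (1 - (q.1 : ℝ)) * s + (q.1 : ℝ) * s' := by
      rcases eq_or_lt_of_le q.1.2.1 with h | h
      · rw [← h]; simpa using hs
      · nlinarith [q.1.2.2]
    refine ⟨hνM _, ?_⟩
    rintro ⟨u, hu⟩
    rw [← hν0] at hu
    have h2 := congrArg Prod.snd (hνinj hu)
    have h3 := congrArg (fun v : EuclideanSpace ℝ (Fin 2) => v 0) h2
    simp at h3
    linarith
  refine loopClass_eq_of_free_family (fun q => ⟨_, hmem q⟩) (Continuous.subtype_mk (hν.comp (by fun_prop)) _)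
    (fun a => Subtype.ext ?_) γ γ' (fun t => Subtype.ext ?_) (fun t => Subtype.ext ?_)
  · show νK _ = νK _
    simp only [Set.Icc.coe_zero, Set.Icc.coe_one, mul_zero, mul_one]
    rw [← zero_add (2 * Real.pi), circlePoint_add_two_pi]
  · rw [hγ t]; show νK _ = νK _; simp
  · rw [hγ' t]; show νK _ = νK _; simp

/-! ## The normal disc of the outer core circle -/

/-- **In `M_k ∖ K₁` the fibre circle of the outer core bounds** (`0 < ε ≤ 1/40`, `|w|² ≥ ε` on `K₁`): the
`w`-circle `t ↦ (z₁, (√ε/2) e^{2πit})` over a far planar point `z₁` (latitude coordinate in the outer collar,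
potential `1 − ε/4`) has Hurewicz class `0` in `{y ∈ M_k | y ∉ K₁}`. [cite: Kirby1989, Ch. I §2] -/
theorem loopClass_outerFibre_eq_zero {k : ℕ} {ε : ℝ} (hε : 0 < ε) (hε' : ε ≤ 1 / 40)
    (K₁ : (sphere (0 : EuclideanSpace ℝ (Fin 2)) 1) → EuclideanSpace ℝ (Fin 4)) (hK : ∀ u, ε ≤ ‖wC (K₁ u)‖ ^ 2)
    (z₁ : ℂ) (hco : coLat k z₁ ≠ 0) (hlat : 0 < latS k z₁)
    (hann : latCoord k z₁ ∈ annulus 0 (latC k - 1 / 50) (latC k + 1 / 50)) (hpot : planarPot k z₁ = 1 - ε / 4)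
    {p : ↥{y : EuclideanSpace ℝ (Fin 4) | y ∈ modelBoundary k ∧ y ∉ range K₁}} (γ : Path p p)
    (hγ : ∀ t, ((γ t : ↥{y : EuclideanSpace ℝ (Fin 4) | y ∈ modelBoundary k ∧ y ∉ range K₁}) : EuclideanSpace ℝ (Fin 4)) =
      ofZW z₁ (((Real.sqrt ε / 2 : ℝ) : ℂ) * Complex.exp ((2 * Real.pi * t : ℝ) * Complex.I))) :
    loopClass ℤ ℤ (1 : ℤ) γ = 0 := by
  have hk : (0 : ℝ) ≤ k := Nat.cast_nonneg k
  have hc1 := lt_latC (k := k)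
  have hc2 := latC_lt (k := k)
  set q₁ := latCoord k z₁ with hq₁
  obtain ⟨hq0, hq0', hq1, hband⟩ := outer_annulus_bounds hann
  set e : EuclideanSpace ℝ (Fin 2) := toE2 (unitDir 0 q₁) with hedef
  have he : ‖e‖ = 1 := by rw [hedef, norm_toE2, norm_unitDir hq0]
  have hz₁e : outerZ k e ‖q₁‖ = z₁ := by
    show latCoordInv k q₁ = z₁; exact latCoordInv_latCoord hco hlat
  have hg1 : planarPot k (outerZ k e ‖q₁‖) = 1 - ε / 4 := by rw [hz₁e, hpot]
  -- the latitude of `z₁` is at least `c_k`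
  have hqc : latC k ≤ ‖q₁‖ := by
    by_contra h; push Not at h
    have := one_lt_planarPot_outerZ he hq0' h (k := k)
    linarith
  -- the latitude `r₁` of the outer core point on the meridian of `z₁`
  have hsub : Icc (latC k - 1 / 100) ‖q₁‖ ⊆ outerBand k := fun s hs => ⟨by linarith [hs.1], le_trans hs.2 hband.2⟩
  have hcont : ContinuousOn (fun s : ℝ => planarPot k (outerZ k e s)) (Icc (latC k - 1 / 100) ‖q₁‖) := fun s hs =>
    (exists_hasDerivAt_planarPot_outerZ he (hsub hs)).choose_spec.1.continuousAt.continuousWithinAt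
  obtain ⟨r₁, hr₁, hgr₁⟩ : ∃ r₁, r₁ ∈ Icc (latC k - 1 / 100) ‖q₁‖ ∧ planarPot k (outerZ k e r₁) = 1 := by
    refine intermediate_value_Icc' (by linarith) hcont ⟨by rw [hg1]; linarith, ?_⟩
    have := one_lt_planarPot_outerZ he (s := latC k - 1 / 100) (by linarith) (by linarith) (k := k); exact this.le
  have hanti := planarPot_outerZ_strictAntiOn he (k := k)
  -- the latitude path `a ↦ s a` from `|q₁|` to `r₁` and the bounds along it
  have hsI : ∀ a : I, ‖q₁‖ + (a : ℝ) * (r₁ - ‖q₁‖) ∈ Icc r₁ ‖q₁‖ := fun a =>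
    ⟨by nlinarith [a.2.1, a.2.2, hr₁.2], by nlinarith [a.2.1, a.2.2, hr₁.2]⟩
  have hbandI : ∀ a : I, ‖q₁‖ + (a : ℝ) * (r₁ - ‖q₁‖) ∈ outerBand k := fun a => hsub ⟨by linarith [(hsI a).1, hr₁.1], (hsI a).2⟩
  have hgI : ∀ a : I, 1 - ε / 4 ≤ planarPot k (outerZ k e (‖q₁‖ + (a : ℝ) * (r₁ - ‖q₁‖))) ∧
      planarPot k (outerZ k e (‖q₁‖ + (a : ℝ) * (r₁ - ‖q₁‖))) ≤ 1 := fun a =>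
    ⟨by rw [← hg1]; exact hanti.antitoneOn (hbandI a) hband (hsI a).2,
     by rw [← hgr₁]; exact hanti.antitoneOn (hsub ⟨hr₁.1, hr₁.2⟩) (hbandI a) (hsI a).1⟩
  -- the homotopy
  set Z : I → ℂ := fun a => outerZ k e (‖q₁‖ + (a : ℝ) * (r₁ - ‖q₁‖)) with hZdef
  set wa : I → ℂ := fun a => ((Real.sqrt (1 - planarPot k (Z a)) : ℝ) : ℂ) with hwa
  have hn : ∀ p : I × I, ‖wa p.1 * Complex.exp ((2 * Real.pi * p.2 : ℝ) * Complex.I)‖ ^ 2 = 1 - planarPot k (Z p.1) := fun p => by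
    rw [norm_mul, Complex.norm_exp_ofReal_mul_I, mul_one, hwa]
    simp only
    rw [Complex.norm_real, Real.norm_of_nonneg (Real.sqrt_nonneg _), Real.sq_sqrt (by linarith [(hgI p.1).2])]
  have hmem : ∀ p : I × I, ofZW (Z p.1) (wa p.1 * Complex.exp ((2 * Real.pi * p.2 : ℝ) * Complex.I)) ∈
      {y : EuclideanSpace ℝ (Fin 4) | y ∈ modelBoundary k ∧ y ∉ range K₁} := by
    intro p
    obtain ⟨hlo, hhi⟩ := hgI p.1
    refine ⟨?_, ?_⟩
    · rw [← mem_Mset_iff, zC_ofZW, wC_ofZW]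
      refine ⟨fun i => ?_, by rw [hn]; ring⟩
      have := norm_outerZ_sub_holeCentre_ge he (hbandI p.1) i
      show 1 ≤ ‖Z p.1 - holeCentre k i‖
      rw [hZdef]; linarith
    · rintro ⟨u, hu⟩
      have := hK u
      rw [hu, wC_ofZW, hn] at this
      linarith
  have hcontF : Continuous fun p : I × I => ofZW (Z p.1) (wa p.1 * Complex.exp ((2 * Real.pi * p.2 : ℝ) * Complex.I)) := by
    have hZ : Continuous Z := by
      refine continuous_iff_continuousAt.2 fun a => ?_
      have hs0 : 0 < ‖q₁‖ + (a : ℝ) * (r₁ - ‖q₁‖) := by linarith [(hsI a).1, hr₁.1]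
      have hs1 : ‖q₁‖ + (a : ℝ) * (r₁ - ‖q₁‖) < 1 := by linarith [(hsI a).2]
      exact ContinuousAt.comp (g := fun p : EuclideanSpace ℝ (Fin 2) × ℝ => outerZ k p.1 p.2)
        (f := fun a : I => (e, ‖q₁‖ + (a : ℝ) * (r₁ - ‖q₁‖))) (x := a)
        (contDiffAt_outerZ (q := (e, ‖q₁‖ + (a : ℝ) * (r₁ - ‖q₁‖))) (n := ∞) he.le hs0 hs1).continuousAt (by fun_prop)
    have hG : Continuous fun a : I => planarPot k (Z a) := by
      refine continuous_iff_continuousAt.2 fun a => ?_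
      exact ContinuousAt.comp (g := fun s : ℝ => planarPot k (outerZ k e s)) (f := fun a : I => ‖q₁‖ + (a : ℝ) * (r₁ - ‖q₁‖)) (x := a)
        (exists_hasDerivAt_planarPot_outerZ he (hbandI a)).choose_spec.1.continuousAt (by fun_prop)
    have hw : Continuous wa := Complex.continuous_ofReal.comp (continuous_const.sub hG).sqrt
    exact continuous_ofZW.comp ((hZ.comp continuous_fst).prodMk ((hw.comp continuous_fst).mul (by fun_prop)))
  refine loopClass_eq_zero_of_free_family (fun p => ⟨_, hmem p⟩) (hcontF.subtype_mk _) (fun a => Subtype.ext ?_) γ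
    (fun t => Subtype.ext ?_) (fun t => Subtype.ext ?_)
  · show ofZW _ _ = ofZW _ _
    congr 2
    simp only [Set.Icc.coe_zero, Set.Icc.coe_one, mul_zero, mul_one]
    rw [show ((2 * Real.pi : ℝ) : ℂ) * Complex.I = 2 * Real.pi * Complex.I by push_cast; ring, Complex.exp_two_pi_mul_I]
    simp
  · rw [hγ t]
    show ofZW _ _ = ofZW _ _
    have hZ0 : Z 0 = z₁ := by rw [hZdef]; simp only [Set.Icc.coe_zero, zero_mul, add_zero]; exact hz₁e
    have hw0 : wa 0 = ((Real.sqrt ε / 2 : ℝ) : ℂ) := by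
      rw [hwa]; simp only; rw [hZ0, hpot]
      congr 1
      rw [show (1 - (1 - ε / 4) : ℝ) = (Real.sqrt ε / 2) ^ 2 by rw [div_pow, Real.sq_sqrt hε.le]; ring,
        Real.sqrt_sq (by positivity)]
    rw [hZ0, hw0]
  · show ofZW _ _ = ofZW _ _
    have hZ1 : Z 1 = outerZ k e r₁ := by rw [hZdef]; simp only [Set.Icc.coe_one, one_mul, add_sub_cancel]
    have hw1 : wa 1 = 0 := by rw [hwa]; simp only; rw [hZ1, hgr₁, sub_self, Real.sqrt_zero, Complex.ofReal_zero]
    rw [hw1, zero_mul, zero_mul]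

end FriendsCarrierVk

open FriendsCarrierVk in
/-- **Piece 9 of part I of V_k part A**: the Mayer–Vietoris step (a class of `H₁(U)` dying in `X = U ∪ V` lifts to
`H₁(U ∩ V)` with zero image in `H₁(V)`) and the normal disc of the outer core circle (the `w`-circle over a far
planar point of potential `1 − ε/4` is null-homologous in `M_k ∖ K₁` when `|w|² ≥ ε` on `K₁`).
[cite: HatcherAT2002, §2.2 p. 149] [cite: Kirby1989, Ch. I §2] -/
theorem helper_friendsCarrier_Vk_partA_partI_transfer : (∀ (X : Type) [TopologicalSpace X] (U V : Set X), IsOpen U → IsOpen V → U ∪ V = univ → ∀ c : Literature.AlgebraicTopology.SingularHomology.singularHomology ℤ ℤ ↥U 1, Literature.AlgebraicTopology.SingularHomology.singularHomology.map ℤ ℤ (Literature.AlgebraicTopology.SingularHomology.subsetIncl U) 1 c = 0 → ∃ e : Literature.AlgebraicTopology.SingularHomology.singularHomology ℤ ℤ ↥(U ∩ V) 1, Literature.AlgebraicTopology.SingularHomology.singularHomology.map ℤ ℤ (Literature.AlgebraicTopology.SingularHomology.subsetInclusion inter_subset_left) 1 e = c ∧ Literature.AlgebraicTopology.SingularHomology.singularHomology.map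 ℤ ℤ (Literature.AlgebraicTopology.SingularHomology.subsetInclusion inter_subset_right) 1 e = 0) ∧ ∀ (k : ℕ) (ε : ℝ), 0 < ε → ε ≤ 1 / 40 → ∀ (K₁ : (sphere (0 : EuclideanSpace ℝ (Fin 2)) 1) → EuclideanSpace ℝ (Fin 4)), (∀ u, ε ≤ ‖wC (K₁ u)‖ ^ 2) → ∀ (z₁ : ℂ), coLat k z₁ ≠ 0 → 0 < latS k z₁ → latCoord k z₁ ∈ annulus 0 (latC k - 1 / 50) (latC k + 1 / 50) → planarPot k z₁ = 1 - ε / 4 → ∀ (p : ↥{y : EuclideanSpace ℝ (Fin 4) | y ∈ modelBoundary k ∧ y ∉ range K₁}) (γ : Path p p), (∀ t : unitInterval, ((γ t : ↥{y : EuclideanSpace ℝ (Fin 4) | y ∈ modelBoundary k ∧ y ∉ range K₁}) : EuclideanSpace ℝ (Fin 4)) = ofZW z₁ (((Real.sqrt ε / 2 : ℝ) : ℂ) * Complex.exp ((2 * Real.pi * t : ℝ) * Complex.I))) → Literature.AlgebraicTopology.SingularHomology.loopClass ℤ ℤ (1 : ℤ) γ = 0 :=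
  ⟨fun _ _ U V hU hV hUV c hc => mv_exists_of_map_eq_zero U V hU hV hUV c hc,
    fun _ _ hε hε' K₁ hK z₁ hco hlat hann hpot _ γ hγ => loopClass_outerFibre_eq_zero hε hε' K₁ hK z₁ hco hlat hann hpot γ hγ⟩

end Summit.SmoothPoincare4.SmoothPoincare4.Theorems.DcrGap.MkFriends
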